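import Summits.BirchSwinnertonDyer.Rank1Residual.ManinAdditive.Gamma1LatticeBalancedCuspDifferences
import Summits.BirchSwinnertonDyer.BirchSwinnertonDyer.Theorems.ManinLocalTwoThreePrimeClassGeneration
import HarnessLib

/-!
# THEOREM B′ (es g18, MEMO-es §31.17; T-es-23): PRIME conductors `ℓ > n₀` in ONE class `ℓ ≡ ε (mod N)`, `ε = ±1`,
# already generate `Λ₁(f)` by balanced cusp differences — PROVED (cell `bsd-f2-manin`, typer g13)

`periodLatticeGamma1_eq_closure_balancedCuspDiffsPrime` (Dirichlet through the tree's
`…Theorems.ManinLocalTwoThree.cuspSymbol_mem_closure_primeClass` — file `ManinLocalTwoThreePrimeClassGeneration`, which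
imports Literature only, so this module is outside the theses cone).  SOURCE: HOME/es/Sketch-es-g18-bal.lean
00ba62a68f72b567 §4e′, VERBATIM up to the namespace; REF1 §R67: PROVED (closures standard); port GO.
Nothing about BSD or any Manin constant is asserted.  PARTITION 0 · beyond-print theorem: no · BSD is not proved by this.
-/

set_option autoImplicit false

noncomputable section

open scoped MatrixGroups ModularForm

open CongruenceSubgroup Literature.NumberTheory.EllipticCurves
  Literature.NumberTheory.EllipticCurves.ModularForms

namespace Summit.BirchSwinnertonDyer.Rank1Residual.ManinAdditive.Gamma1Lattice

variable {N : ℕ} [NeZero N] (f : CuspForm (Gamma0 N) 2)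

/-! ### §4e′ — THEOREM B′: PRIME conductors in ONE class `ℓ ≡ ε (mod N)`, `ε = ±1`, `ℓ > n₀` suffice
(Dirichlet along the progression `d + N b ℤ`, tree idiom `exists_gamma0_lowerMul`). At `4 ∣ N` the class
`ε = -1` consists of primes `ℓ ≡ 3 (mod 4)`; at `3 ∣ N` of primes `ℓ ≡ 2 (mod 3)` — the P-trivial conductors
of MEMO-es §31.11, so AVG⋆ there is a THEOREM. -/

/-- Balanced cusp differences at PRIME conductors `ℓ > n₀` in the class `ℓ ≡ ε (mod N)`. -/
def balancedCuspDiffsPrime (n₀ : ℕ) (ε : ℤ) : Set ℂ :=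
  {z | ∃ (ℓ : ℕ) (b b' : ℤ), ℓ.Prime ∧ n₀ < ℓ ∧ ((ℓ : ℤ) : ZMod N) = (ε : ZMod N) ∧
      IsCoprime b ℓ ∧ IsCoprime b' ℓ ∧
      z = modularSymbol f ((b : ℚ) / (ℓ : ℤ)) - modularSymbol f ((b' : ℚ) / (ℓ : ℤ))}

omit [NeZero N] in
/-- prime-conductor balanced differences in the class `ε = ±1` are balanced differences. -/
theorem balancedCuspDiffsPrime_subset (n₀ : ℕ) {ε : ℤ} (hε : ε = 1 ∨ ε = -1) :
    balancedCuspDiffsPrime f n₀ ε ⊆ balancedCuspDiffs f := by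
  rintro z ⟨ℓ, b, b', hp, -, hℓε, hb, hb', rfl⟩
  refine ⟨(ℓ : ℤ), b, b', by exact_mod_cast hp.ne_zero, ?_, hb, hb', rfl⟩
  rcases hε with h | h
  · left; rw [hℓε, h]; push_cast; rfl
  · right; rw [hℓε, h]; push_cast; rfl

open Summit.BirchSwinnertonDyer.BirchSwinnertonDyer.Theorems.ManinLocalTwoThree in
/-- Core of THEOREM B′: a `Γ₀(N)`-matrix with lower-right entry `≡ ε = ±1 (mod N)` has its period among
the balanced prime-conductor differences of class `ε`. -/
theorem cuspSymbol_mem_closure_balancedCuspDiffsPrime (hN : 2 ≤ N) (n₀ : ℕ) {ε : ℤ}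
    (hε : ε = 1 ∨ ε = -1) (δ : Gamma0 N)
    (hdε : (((δ : SL(2, ℤ)) 1 1 : ℤ) : ZMod N) = (ε : ZMod N)) :
    cuspSymbol f δ ∈ AddSubgroup.closure (balancedCuspDiffsPrime f n₀ ε) := by
  haveI : Fact (1 < N) := ⟨hN⟩
  set b : ℤ := (δ : SL(2, ℤ)) 0 1 with hb
  set d : ℤ := (δ : SL(2, ℤ)) 1 1 with hd
  have hdet := Matrix.SpecialLinearGroup.det_coe (δ : SL(2, ℤ))
  rw [Matrix.det_fin_two, ← hb, ← hd] at hdet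
  obtain ⟨c', hc'⟩ : (N : ℤ) ∣ (δ : SL(2, ℤ)) 1 0 :=
    (ZMod.intCast_zmod_eq_zero_iff_dvd _ N).mp (Gamma0_mem.mp δ.2)
  rw [hc'] at hdet
  -- `ε`-disjunction for any integer congruent to `d`
  have hpm : ∀ {m : ℤ}, (m : ZMod N) = (ε : ZMod N) → (m : ZMod N) = 1 ∨ (m : ZMod N) = -1 := by
    intro m hm
    rcases hε with h | h
    · left; rw [hm, h]; push_cast; rfl
    · right; rw [hm, h]; push_cast; rfl
  -- `d ≠ 0`
  have hd0 : d ≠ 0 := by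
    intro h0
    have h1 := hpm hdε
    rw [h0, Int.cast_zero] at h1
    rcases h1 with h1 | h1
    · exact zero_ne_one h1
    · exact one_ne_zero (neg_eq_zero.mp h1.symm)
  by_cases hb0 : b = 0
  · -- `δ 0 = 0`: the period vanishes
    have h0 : cuspSymbol f δ = 0 := by
      rw [cuspSymbol_eq_modularSymbol_div_sub f δ hd0, ← hb, hb0]
      simp
    rw [h0]
    exact zero_mem _
  · -- Dirichlet on the progression `d + N·b·ℤ`
    have hcopNb : IsCoprime d ((N : ℤ) * b) :=
      ⟨(δ : SL(2, ℤ)) 0 0, -c', by linear_combination hdet⟩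
    have hcopb : IsCoprime d b :=
      ⟨(δ : SL(2, ℤ)) 0 0, -((N : ℤ) * c'), by linear_combination hdet⟩
    set q : ℕ := N * b.natAbs with hq
    have hq0 : q ≠ 0 := mul_ne_zero (NeZero.ne N) (Int.natAbs_ne_zero.mpr hb0)
    have hqabs : (q : ℤ) = N * |b| := by
      rw [hq]
      push_cast
      ring
    have hqZ : (q : ℤ) = N * b ∨ (q : ℤ) = -(N * b) := by
      rcases abs_choice b with h | h
      · left
        rw [hqabs, h]
      · right
        rw [hqabs, h]
        ring
    have hcopq : IsCoprime d (q : ℤ) := by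
      rcases hqZ with h | h
      · rw [h]; exact hcopNb
      · rw [h]; exact hcopNb.neg_right
    obtain ⟨ℓ, hℓn, hℓp, hℓd⟩ := Nat.forall_exists_prime_gt_and_zmodEq (max n₀ 1) hq0 hcopq
    obtain ⟨k, hk⟩ : ∃ k : ℤ, (ℓ : ℤ) = d + N * k * b := by
      obtain ⟨t, ht⟩ := (Int.modEq_iff_dvd.mp hℓd)
      rcases hqZ with h | h
      · exact ⟨-t, by rw [h] at ht; linear_combination -ht⟩
      · exact ⟨t, by rw [h] at ht; linear_combination -ht⟩
    obtain ⟨γ', h01', h11', hγ'⟩ := exists_gamma0_lowerMul f δ k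
    rw [← hb] at h01'
    rw [← hb, ← hd, ← hk] at h11'
    have hℓ0 : (ℓ : ℤ) ≠ 0 := by exact_mod_cast hℓp.ne_zero
    -- `ℓ ≡ d ≡ ε (mod N)`
    have hℓN : (ℓ : ℤ) ≡ d [ZMOD N] := by
      have hdvd : (N : ℤ) ∣ (q : ℤ) := by rw [hqabs]; exact Dvd.intro _ rfl
      exact Int.ModEq.of_dvd hdvd hℓd
    have hℓε : ((ℓ : ℤ) : ZMod N) = (ε : ZMod N) :=
      ((ZMod.intCast_eq_intCast_iff _ _ _).mpr hℓN).trans hdε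
    -- the period as a prime-conductor class, and the zero cycle at conductor `ℓ`
    have hper : cuspSymbol f δ = modularSymbol f ((b : ℚ) / (ℓ : ℤ)) - modularSymbol f 0 := by
      rw [← hγ', cuspSymbol_eq_modularSymbol_div_sub f γ' (by rw [h11']; exact hℓ0), h01', h11']
    obtain ⟨b₀, hb₀, hz⟩ := exists_modularSymbol_div_eq_zero f hℓ0 (hpm hℓε)
    have hcopbℓ : IsCoprime b (ℓ : ℤ) := by
      rw [hk]
      exact hcopb.symm.add_mul_right_right ((N : ℤ) * k)
    have hmem : modularSymbol f ((b : ℚ) / (ℓ : ℤ)) - modularSymbol f ((b₀ : ℚ) / (ℓ : ℤ))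
        ∈ balancedCuspDiffsPrime f n₀ ε :=
      ⟨ℓ, b, b₀, hℓp, lt_of_le_of_lt (le_max_left _ _) hℓn, hℓε, hcopbℓ, hb₀, rfl⟩
    have : cuspSymbol f δ = modularSymbol f ((b : ℚ) / (ℓ : ℤ)) -
        modularSymbol f ((b₀ : ℚ) / (ℓ : ℤ)) := by rw [hper, hz]
    rw [this]
    exact AddSubgroup.subset_closure hmem

/-- **THEOREM B′ (prime conductors in one class).** For `N ≥ 2`, `ε = ±1` and any `n₀`, `Λ₁(f)` is the
subgroup of `ℂ` generated by the balanced cusp differences `{∞, b/ℓ}_f − {∞, b'/ℓ}_f` at PRIME conductors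
`ℓ > n₀`, `ℓ ≡ ε (mod N)`. -/
theorem periodLatticeGamma1_eq_closure_balancedCuspDiffsPrime (hN : 2 ≤ N) (n₀ : ℕ) {ε : ℤ}
    (hε : ε = 1 ∨ ε = -1) :
    periodLatticeGamma1 f = AddSubgroup.closure (balancedCuspDiffsPrime f n₀ ε) := by
  refine le_antisymm ?_ ((AddSubgroup.closure_le _).mpr
    (Set.Subset.trans (balancedCuspDiffsPrime_subset f n₀ hε) (balancedCuspDiffs_subset f)))
  unfold periodLatticeGamma1
  refine (AddSubgroup.closure_le _).mpr ?_
  rintro _ ⟨γ, rfl⟩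
  have hγ1 := (Gamma1_mem N (γ : SL(2, ℤ))).mp γ.2
  rcases hε with h | h
  · subst h
    exact cuspSymbol_mem_closure_balancedCuspDiffsPrime f hN n₀ (Or.inl rfl) _
      (by push_cast; exact hγ1.2.1)
  · subst h
    have e10 : ((-((γ : SL(2, ℤ)))) 1 0 : ℤ) = -(((γ : SL(2, ℤ))) 1 0) := by
      simp [Matrix.SpecialLinearGroup.coe_neg]
    have e11 : ((-((γ : SL(2, ℤ)))) 1 1 : ℤ) = -(((γ : SL(2, ℤ))) 1 1) := by
      simp [Matrix.SpecialLinearGroup.coe_neg]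
    have hG0 : (-((γ : SL(2, ℤ)))) ∈ Gamma0 N := by
      rw [Gamma0_mem, e10]; push_cast; rw [hγ1.2.2, neg_zero]
    have key := cuspSymbol_mem_closure_balancedCuspDiffsPrime f hN n₀ (Or.inr rfl) ⟨_, hG0⟩
      (by
        show (((-((γ : SL(2, ℤ)))) 1 1 : ℤ) : ZMod N) = ((-1 : ℤ) : ZMod N)
        rw [e11]; push_cast; rw [hγ1.2.1])
    have e : cuspSymbol f ⟨(γ : SL(2, ℤ)), Gamma1_in_Gamma0 N γ.2⟩ =
        cuspSymbol f ⟨-((γ : SL(2, ℤ))), hG0⟩ :=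
      (cuspSymbol_neg f ⟨(γ : SL(2, ℤ)), Gamma1_in_Gamma0 N γ.2⟩ hG0).symm
    show cuspSymbol f ⟨(γ : SL(2, ℤ)), Gamma1_in_Gamma0 N γ.2⟩ ∈
      (AddSubgroup.closure (balancedCuspDiffsPrime f n₀ (-1)) : Set ℂ)
    rw [e]
    exact key

end Summit.BirchSwinnertonDyer.Rank1Residual.ManinAdditive.Gamma1Lattice

end
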